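import Summits.ValiantsHypothesis.ValiantsHypothesis.Theorems.BarrierLeverPriorityPeelingCertificateExamples

/-!
# Route BarrierLever — priority peeling for TT: MACHINE-EMITTED kernel certificates

Helper file (`--supports stmt-ValiantsHypothesis-19616`; cell valiant-natproofs, rung V4, 𝒟-side;
prover gen 7; memo `HOME/prover/gen7/PP-MEMO-g7.md` §5b). Closes NO item. The certificates below were
EMITTED MECHANICALLY by `HOME/prover/gen7/pp_emit.py` from the search `pp_search.py` (pair moves with
priority lists across column pairs, shears, transposes, re-indexing) in the format of
`PriorityPeeling.PPDerivable` (tree file `…PriorityPeelingCertificate`) and are checked by the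
kernel (all side conditions by `decide`); with `alive_of_ppDerivable` each gives the TT conclusion
(item 19152) for its layout. Both layouts belong to item 19616's R1/R2-IRREDUCIBLE core.

WHAT THIS IS NOT: two layouts, not the conjecture; nothing on crux stmt-ValiantsHypothesis-14610 or
on `VP` versus `VNP`.
-/

-- layout Summits/ValiantsHypothesis/ValiantsHypothesis forces the duplicated namespace component
set_option linter.dupNamespace false

namespace Summit.ValiantsHypothesis.ValiantsHypothesis.Theorems.BarrierLever.PriorityPeeling


/-- **Kernel certificate** (machine-emitted priority-peeling derivation): the planner's h = 3 core example (kit j253855): rows `{∅,{2},{1},{1,2}}` (a 2-face) against columns `{{2},{0},{0,2},{0,1,2}}` — R1/R2-irreducible. -/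
theorem coreFace_v_001_100_101_111_derivable : PPDerivable 6 6 (Fin 4) 3
    (fun i a => if a ∈ (![∅, {2}, {1}, {1, 2}] : Fin 4 → Finset (Fin 3)) i
      then Fin.castAdd 3 a else Fin.natAdd 3 a)
    (fun j c => if c ∈ (![{2}, {0}, {0, 2}, {0, 1, 2}] : Fin 4 → Finset (Fin 3)) j
      then Fin.natAdd 3 c else Fin.castAdd 3 c) :=
  (PPDerivable.pair _ _ (0 : Fin 6) (3 : Fin 6) (by decide) (fun i => (![true, true, true, true] : Fin 4 → Bool) i) (fun i => (![0, 0, 0, 0] : Fin 4 → Fin 3) i) (by decide) (by decide) (∅ : Finset (Fin 6)) ({0, 1, 3} : Finset (Fin 6)) (fun m : Fin 6 => if m = 0 then 3 else if m = 1 then 2 else if m = 3 then 1 else 0) (fun j => (![true, true, true, true] : Fin 4 → Bool) j) (fun j => (![0, 1, 1, 0] : Fin 4 → Fin 3) j) (by decide) (by decide)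
    (Equiv.refl (Fin 4)) (by decide)
    (@PPDerivable.of_isEmpty 6 6 (0 : Fin 6) (1 : Fin 6) (by decide) 2 ({x : Fin 4 // (fun i => (![true, true, true, true] : Fin 4 → Bool) i) x = false}) _ _ ⟨fun x => (by decide : ∀ y : {x : Fin 4 // (fun i => (![true, true, true, true] : Fin 4 → Bool) i) x = false}, False) x⟩ _ _)
    (PPDerivable.reindex _ _ (Equiv.refl ({x : Fin 4 // ¬ (fun i => (![true, true, true, true] : Fin 4 → Bool) i) x = false})) ((Equiv.swap ((⟨(0 : Fin 4), by decide⟩ : {x : Fin 4 // ¬ (fun i => (![true, true, true, true] : Fin 4 → Bool) i) x = false}) : {x : Fin 4 // ¬ (fun i => (![true, true, true, true] : Fin 4 → Bool) i) x = false}) ((⟨(1 : Fin 4), by decide⟩ : {x : Fin 4 // ¬ (fun i => (![true, true, true, true] : Fin 4 → Bool) i) x = false}) : {x : Fin 4 // ¬ (fun i => (![true, true, true, true] : Fin 4 → Bool) i) x = false})).trans (Equiv.swap ((⟨(0 : Fin 4), by decide⟩ : {x : Fin 4 // ¬ (fun i => (![true, true, true, true] : Fin 4 → Bool) i) x = false})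 : {x : Fin 4 // ¬ (fun i => (![true, true, true, true] : Fin 4 → Bool) i) x = false}) ((⟨(2 : Fin 4), by decide⟩ : {x : Fin 4 // ¬ (fun i => (![true, true, true, true] : Fin 4 → Bool) i) x = false}) : {x : Fin 4 // ¬ (fun i => (![true, true, true, true] : Fin 4 → Bool) i) x = false})))
      (PPDerivable.pair _ _ (4 : Fin 6) (1 : Fin 6) (by decide) (fun i => (![false, false, true, true] : Fin 4 → Bool) i.1) (fun i => (![0, 0, 0, 0] : Fin 4 → Fin 2) i.1) (by decide) (by decide) ({3} : Finset (Fin 6)) ({1, 5} : Finset (Fin 6)) (fun m : Fin 6 => if m = 3 then 3 else if m = 1 then 2 else if m = 5 then 1 else 0) (fun j => (![false, false, true, true] : Fin 4 → Bool) j.1) (fun j => (![0, 0, 0, 1] : Fin 4 → Fin 2) j.1) (by decide) (by decide)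
      (Equiv.refl ({x : Fin 4 // ¬ (fun i => (![true, true, true, true] : Fin 4 → Bool) i) x = false})) (by decide)
      (PPDerivable.rank_one _ _ (by decide) (by decide))
      (PPDerivable.rank_one _ _ (by decide) (by decide)))))


/-- **Kernel certificate** (machine-emitted priority-peeling derivation): h = 4, r = 5: W₀∪W₁ against W₀∪W₃ — one of the «irreducible WITH COMMON POINTS» weight-class unions of kit j253855 / UTD-memo-g10 §4. -/
theorem weightClasses01_v_03_h4_derivable : PPDerivable 8 8 (Fin 5) 4
    (fun i a => if a ∈ (![∅, {3}, {2}, {1}, {0}] : Fin 5 → Finset (Fin 4)) i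
      then Fin.castAdd 4 a else Fin.natAdd 4 a)
    (fun j c => if c ∈ (![∅, {1, 2, 3}, {0, 2, 3}, {0, 1, 3}, {0, 1, 2}] : Fin 5 → Finset (Fin 4)) j
      then Fin.natAdd 4 c else Fin.castAdd 4 c) :=
  (PPDerivable.pair _ _ (4 : Fin 8) (0 : Fin 8) (by decide) (fun i => (![false, false, false, false, true] : Fin 5 → Bool) i) (fun i => (![0, 0, 0, 0, 0] : Fin 5 → Fin 4) i) (by decide) (by decide) ({0, 1, 2} : Finset (Fin 8)) ({4} : Finset (Fin 8)) (fun m : Fin 8 => if m = 0 then 4 else if m = 1 then 3 else if m = 2 then 2 else if m = 4 then 1 else 0) (fun j => (![false, false, false, false, true] : Fin 5 → Bool) j) (fun j => (![0, 0, 1, 2, 0] : Fin 5 → Fin 4) j) (by decide) (by decide)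
    (Equiv.refl (Fin 5)) (by decide)
    (PPDerivable.reindex _ _ (Equiv.refl ({x : Fin 5 // (fun i => (![false, false, false, false, true] : Fin 5 → Bool) i) x = false})) (((Equiv.swap ((⟨(0 : Fin 5), by decide⟩ : {x : Fin 5 // (fun i => (![false, false, false, false, true] : Fin 5 → Bool) i) x = false}) : {x : Fin 5 // (fun i => (![false, false, false, false, true] : Fin 5 → Bool) i) x = false}) ((⟨(3 : Fin 5), by decide⟩ : {x : Fin 5 // (fun i => (![false, false, false, false, true] : Fin 5 → Bool) i) x = false}) : {x : Fin 5 // (fun i => (![false, false, false, false, true] : Fin 5 → Bool) i) x = false})).trans (Equiv.swap ((⟨(1 : Fin 5), by decide⟩ : {x : Fin 5 // (fun i => (![false, false, false, false, true] : Fin 5 → Bool) i) x = false}) : {x : Fin 5 // (fun i => (![false, false, false, false, true] : Fin 5 → Bool) i) x = false}) ((⟨(2 : Fin 5), by decide⟩ : {x : Fin 5 // (fun i => (![false, false, false, false, true] : Fin 5 → Bool) i) x = false}) : {x : Fin 5 // (fun i => (![false, false, false, false, true] : Fin 5 → Bool) i) x = false}))).trans (Equiv.swap ((⟨(1 : Fin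 5), by decide⟩ : {x : Fin 5 // (fun i => (![false, false, false, false, true] : Fin 5 → Bool) i) x = false}) : {x : Fin 5 // (fun i => (![false, false, false, false, true] : Fin 5 → Bool) i) x = false}) ((⟨(0 : Fin 5), by decide⟩ : {x : Fin 5 // (fun i => (![false, false, false, false, true] : Fin 5 → Bool) i) x = false}) : {x : Fin 5 // (fun i => (![false, false, false, false, true] : Fin 5 → Bool) i) x = false})))
      (PPDerivable.pair _ _ (5 : Fin 8) (1 : Fin 8) (by decide) (fun i => (![false, false, false, true, false] : Fin 5 → Bool) i.1) (fun i => (![0, 0, 0, 0, 0] : Fin 5 → Fin 3) i.1) (by decide) (by decide) ({4, 1} : Finset (Fin 8)) ({5} : Finset (Fin 8)) (fun m : Fin 8 => if m = 4 then 3 else if m = 1 then 2 else if m = 5 then 1 else 0) (fun j => (![false, false, false, true, false] : Fin 5 → Bool) j.1) (fun j => (![0, 0, 0, 0, 0] : Fin 5 → Fin 3) j.1) (by decide) (by decide)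
      (Equiv.refl ({x : Fin 5 // (fun i => (![false, false, false, false, true] : Fin 5 → Bool) i) x = false})) (by decide)
      (PPDerivable.reindex _ _ (Equiv.refl ({x : {x : Fin 5 // (fun i => (![false, false, false, false, true] : Fin 5 → Bool) i) x = false} // (fun i => (![false, false, false, true, false] : Fin 5 → Bool) i.1) x = false})) (Equiv.swap ((⟨(⟨(1 : Fin 5), by decide⟩ : {x : Fin 5 // (fun i => (![false, false, false, false, true] : Fin 5 → Bool) i) x = false}), by decide⟩ : {x : {x : Fin 5 // (fun i => (![false, false, false, false, true] : Fin 5 → Bool) i) x = false} // (fun i => (![false, false, false, true, false] : Fin 5 → Bool) i.1) x = false}) : {x : {x : Fin 5 // (fun i => (![false, false, false, false, true] : Fin 5 → Bool) i) x = false} // (fun i => (![false, false, false, true, false] : Fin 5 → Bool) i.1) x = false}) ((⟨(⟨(2 : Fin 5), by decide⟩ : {x : Fin 5 // (fun i => (![false, false, false, false, true] : Fin 5 → Bool) i) x = false}), by decide⟩ : {x : {x : Fin 5 // (fun i => (![false, false, false, false, true] : Fin 5 → Bool) i) x = false} // (fun i => (![false, false, false, true, false] : Fin 5 → Bool) i.1)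 x = false}) : {x : {x : Fin 5 // (fun i => (![false, false, false, false, true] : Fin 5 → Bool) i) x = false} // (fun i => (![false, false, false, true, false] : Fin 5 → Bool) i.1) x = false}))
        (PPDerivable.pair _ _ (2 : Fin 8) (6 : Fin 8) (by decide) (fun i => (![true, true, false, false, false] : Fin 5 → Bool) i.1.1) (fun i => (![0, 0, 0, 0, 0] : Fin 5 → Fin 2) i.1.1) (by decide) (by decide) ({5} : Finset (Fin 8)) ({2, 6} : Finset (Fin 8)) (fun m : Fin 8 => if m = 5 then 3 else if m = 2 then 2 else if m = 6 then 1 else 0) (fun j => (![false, true, true, false, false] : Fin 5 → Bool) j.1.1) (fun j => (![0, 0, 0, 0, 0] : Fin 5 → Fin 2) j.1.1) (by decide) (by decide)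
        ((Equiv.swap ((⟨(⟨(0 : Fin 5), by decide⟩ : {x : Fin 5 // (fun i => (![false, false, false, false, true] : Fin 5 → Bool) i) x = false}), by decide⟩ : {x : {x : Fin 5 // (fun i => (![false, false, false, false, true] : Fin 5 → Bool) i) x = false} // (fun i => (![false, false, false, true, false] : Fin 5 → Bool) i.1) x = false}) : {x : {x : Fin 5 // (fun i => (![false, false, false, false, true] : Fin 5 → Bool) i) x = false} // (fun i => (![false, false, false, true, false] : Fin 5 → Bool) i.1) x = false}) ((⟨(⟨(1 : Fin 5), by decide⟩ : {x : Fin 5 // (fun i => (![false, false, false, false, true] : Fin 5 → Bool) i) x = false}), by decide⟩ : {x : {x : Fin 5 // (fun i => (![false, false, false, false, true] : Fin 5 → Bool) i) x = false} // (fun i => (![false, false, false, true, false] : Fin 5 → Bool) i.1) x = false}) : {x : {x : Fin 5 // (fun i => (![false, false, false, false, true] : Fin 5 → Bool) i) x = false} // (fun i => (![false, false, false, true, false] : Fin 5 → Bool) i.1) x = false})).trans (Equiv.swap ((⟨(⟨(0 : Fin 5), by decide⟩ : {x : Fin 5 // (fun i => (![false, false, false, false, true] : Fin 5 → Bool) i)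 x = false}), by decide⟩ : {x : {x : Fin 5 // (fun i => (![false, false, false, false, true] : Fin 5 → Bool) i) x = false} // (fun i => (![false, false, false, true, false] : Fin 5 → Bool) i.1) x = false}) : {x : {x : Fin 5 // (fun i => (![false, false, false, false, true] : Fin 5 → Bool) i) x = false} // (fun i => (![false, false, false, true, false] : Fin 5 → Bool) i.1) x = false}) ((⟨(⟨(2 : Fin 5), by decide⟩ : {x : Fin 5 // (fun i => (![false, false, false, false, true] : Fin 5 → Bool) i) x = false}), by decide⟩ : {x : {x : Fin 5 // (fun i => (![false, false, false, false, true] : Fin 5 → Bool) i) x = false} // (fun i => (![false, false, false, true, false] : Fin 5 → Bool) i.1) x = false}) : {x : {x : Fin 5 // (fun i => (![false, false, false, false, true] : Fin 5 → Bool) i) x = false} // (fun i => (![false, false, false, true, false] : Fin 5 → Bool) i.1) x = false}))) (by decide)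
        (PPDerivable.single _ _ (⟨(⟨(⟨(2 : Fin 5), by decide⟩ : {x : Fin 5 // (fun i => (![false, false, false, false, true] : Fin 5 → Bool) i) x = false}), by decide⟩ : {x : {x : Fin 5 // (fun i => (![false, false, false, false, true] : Fin 5 → Bool) i) x = false} // (fun i => (![false, false, false, true, false] : Fin 5 → Bool) i.1) x = false}), by decide⟩ : {x : {x : {x : Fin 5 // (fun i => (![false, false, false, false, true] : Fin 5 → Bool) i) x = false} // (fun i => (![false, false, false, true, false] : Fin 5 → Bool) i.1) x = false} // (fun i => (![true, true, false, false, false] : Fin 5 → Bool) i.1.1) x = false}) (by decide) (by decide) (by decide))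
        (PPDerivable.rank_one _ _ (by decide) (by decide))))
      (PPDerivable.single _ _ (⟨(⟨(3 : Fin 5), by decide⟩ : {x : Fin 5 // (fun i => (![false, false, false, false, true] : Fin 5 → Bool) i) x = false}), by decide⟩ : {x : {x : Fin 5 // (fun i => (![false, false, false, false, true] : Fin 5 → Bool) i) x = false} // ¬ (fun i => (![false, false, false, true, false] : Fin 5 → Bool) i.1) x = false}) (by decide) (by decide) (by decide))))
    (PPDerivable.single _ _ (⟨(4 : Fin 5), by decide⟩ : {x : Fin 5 // ¬ (fun i => (![false, false, false, false, true] : Fin 5 → Bool) i) x = false}) (by decide) (by decide) (by decide)))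


end Summit.ValiantsHypothesis.ValiantsHypothesis.Theorems.BarrierLever.PriorityPeeling
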